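/-
Copyright (c) 2026 the pub-hodgecm-mathlib formalisation cell (harness21).  Prover seat hodgecm-mathlib-K2Liu-p09 (g6): Track B «K2-LIT»,
hLiu418 = stmt-HodgeConjecture-24832; LEAD F0P6-plan RULINGS M-156m∕M-157q, file V1b of the A7-val census (road (σ), (M1)∕(M4)).
-/
import Summits.HodgeConjecture.HodgeConjecture.Theorems.K2LiuA7ValueFunctional   -- ★ V1 `value_eq_sum`, `absDetDelta_eq_of_mul_eq_mul`, `apply_eq_cpow_mul_apply`
import HarnessLib

/-!
# Crux `HLiu418`, road `K2_Liu`, organ A7-val, file V1b: THE VALUE AT `½` DOES NOT DEPEND ON THE IWASAWA COMPACT (after the volume normalisation)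

Cell `hodgecm-mathlib`, crux item hLiu418 = `stmt-HodgeConjecture-24832`; squad K2 ∕ K2Liu; prover K2Liu-p09 (g6).  THEOREMS ONLY; lane
`--supports stmt-HodgeConjecture-24832` (count-neutral helper).  RANK-GENERIC, frame-free; the (A4′-R) face enters in the ∀∃-shape `hA4R` of ★ V1.
THE POINT (A7-val census (M1), input of (M4)).  The (A4′-R) face is stated with an Iwasawa compact `K₀ ≤ H_v` as DATA: the family is `K₀`-flat and the normaliser is
`aNorm n χ_v (νN(N_Δ ∩ K₀)) s`.  For a second Iwasawa compact `K₀′` and the `K₀′`-flat family `f′` through the SAME section `φ = f(½) = f′(½)`, the two values are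
PROPORTIONAL BY THE VOLUMES: **`vol′ · Fn′(½) h = vol · Fn(½) h`** (`value_reflatten`).  MECHANISM (as ★ V1 `value_translate`, with `g = 1` and two heights):
`f′ s = (ν′∕ν)^{s−½} · f s`, the ratio `ν′(x)∕ν(x) = q_v^{e(x)}` is left-`P_Δ`-invariant and right-`K₀ ∩ K₀′`-invariant, hence takes finitely many values on the
compact `K₀`; the pieces `𝟙[e = m] · f` are `K₀`-FLAT smooth Siegel families summing to `f`, `f′ s = Σ_m (q_v^m)^{s−½} · piece_m s`, and ★ V1 `value_eq_sum` twice
(`aNorm vol′ = (vol′∕vol) · aNorm vol`).  So the non-vanishing (M4) of the value functional may be tested with ANY convenient Iwasawa compact.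
HONEST LABEL.  `HC_CM` is proved only modulo the 7 printed citations (2 remaining named inputs: hLiu418 = `stmt-HodgeConjecture-24832`,
h413 = `stmt-HodgeConjecture-24833`) until rung 0 closes.

## References
* [KudlaSweet1997] S. Kudla, W. J. Sweet, Israel J. Math. 98 (1997), §1.
* [Casselman1980] W. Casselman, Compositio Math. 40 (1980), §3.
* [HarrisKudlaSweet1996] M. Harris, S. Kudla, W. J. Sweet, J. AMS 9 (1996), §6 (6.14) (the volume factor of the normaliser).
-/

set_option autoImplicit false
set_option linter.dupNamespace false -- the mandated namespace repeats `HodgeConjecture.HodgeConjecture`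

noncomputable section

open scoped Classical NNReal ENNReal
open NumberField IsDedekindDomain MeasureTheory Topology
open Literature.NumberTheory.GaloisRepresentations Literature.NumberTheory.GaloisRepresentations.IsNonarchimedeanLocalField
open Literature.NumberTheory.Automorphic Literature.NumberTheory.Automorphic.UnitaryGroup
open Literature.NumberTheory.GelbartRogawski1991.UnitaryDualPair.LocalSplitting
open Literature.NumberTheory.K2Lit.LocalSiegelDoubled
open Summit.HodgeConjecture.HodgeConjecture.Cruxes.HLiu418.K2LiuQRationalDefs
open Summit.HodgeConjecture.HodgeConjecture.Cruxes.HLiu418.K2LiuLocalLFactorDefs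
open Summit.HodgeConjecture.HodgeConjecture.Cruxes.HLiu418.K2LiuLocalSiegel
open Summit.HodgeConjecture.HodgeConjecture.Cruxes.HLiu418.K2LiuLocalIntertwiningProperty
open Summit.HodgeConjecture.HodgeConjecture.Cruxes.HLiu418.K2LiuFlatSiegelFamilies
open Summit.HodgeConjecture.HodgeConjecture.Cruxes.HLiu418.K2LiuA7ValueFunctional

namespace Summit.HodgeConjecture.HodgeConjecture.Cruxes.HLiu418.K2LiuA7ValueReflatten

variable (F : Type) [Field F] [NumberField F] (E : Type) [Field E] [NumberField E] [Algebra F E]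
  [Algebra.IsQuadraticExtension F E] (c : E ≃ₐ[F] E)
  {δ : E} (hcδ : c δ = -δ) (hδ : δ ≠ 0) {d : F} (hd : δ * δ = algebraMap F E d) (v : HeightOneSpectrum (𝓞 F)) (n : ℕ)
  {T₀ : Matrix (Fin n) (Fin n) F} (hT₀ : T₀.IsSymm) {JD : Matrix (Fin (n + n)) (Fin (n + n)) E} (hJD : JD = (gramD F n T₀).map (algebraMap F E))
  [MeasurableSpace (unipDeltaLocal F E c v n (JD := JD))] (νN : Measure (unipDeltaLocal F E c v n (JD := JD)))
  (χv : ∀ w : PlacesOver E v, (w.1.adicCompletion E)ˣ →* ℂˣ) (vol vol' : ℝ) (hvol : vol ≠ 0)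
  (haN : ∀ s : ℂ, 1 < s.re → aNorm F E c v n χv vol s ≠ 0)
  (K₀ K₀' : Subgroup (UnitaryGroup.localPi E c (n + n) JD v))
  (hK₀ : IsCompact (K₀ : Set (UnitaryGroup.localPi E c (n + n) JD v)) ∧ IsOpen (K₀ : Set (UnitaryGroup.localPi E c (n + n) JD v)))
  (hK₀' : IsCompact (K₀' : Set (UnitaryGroup.localPi E c (n + n) JD v)) ∧ IsOpen (K₀' : Set (UnitaryGroup.localPi E c (n + n) JD v)))
  (hIw : ∀ x : UnitaryGroup.localPi E c (n + n) JD v, ∃ p, IsSiegelDelta F E c hcδ hδ hd v n hT₀ hJD p ∧ ∃ k ∈ K₀, x = p * k)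
  (hIw' : ∀ x : UnitaryGroup.localPi E c (n + n) JD v, ∃ p, IsSiegelDelta F E c hcδ hδ hd v n hT₀ hJD p ∧ ∃ k ∈ K₀', x = p * k)
  (hA4R : ∀ f' : ℂ → UnitaryGroup.localPi E c (n + n) JD v → ℂ, (∀ s, IsLocalSiegelSection F E c hcδ hδ hd v n hT₀ hJD χv s (f' s)) →
    (∀ s, IsSmooth F E c v n (f' s)) → (∀ s s' : ℂ, ∀ k ∈ K₀, f' s k = f' s' k) →
    ∃ Fn' : ℂ → UnitaryGroup.localPi E c (n + n) JD v → ℂ, (∀ h, IsQRationalRegularAt (residueFieldCard (v.adicCompletion F)) (1 / 2) fun s => Fn' s h) ∧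
      ∀ s : ℂ, 1 < s.re → ∀ h, localIntertwining F E c v n hJD νN (f' s) h = aNorm F E c v n χv vol s * Fn' s h)
  (hintA : ∀ f' : ℂ → UnitaryGroup.localPi E c (n + n) JD v → ℂ, (∀ s, IsLocalSiegelSection F E c hcδ hδ hd v n hT₀ hJD χv s (f' s)) →
    (∀ s, IsSmooth F E c v n (f' s)) → (∀ s s' : ℂ, ∀ k ∈ K₀, f' s k = f' s' k) → ∀ s : ℂ, 1 < s.re → ∀ h,
      Integrable (fun u : unipDeltaLocal F E c v n (JD := JD) => f' s (weylDelta F E c v n hJD * (u : UnitaryGroup.localPi E c (n + n) JD v) * h)) νN)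
  {f : ℂ → UnitaryGroup.localPi E c (n + n) JD v → ℂ} (hSieg : ∀ s, IsLocalSiegelSection F E c hcδ hδ hd v n hT₀ hJD χv s (f s))
  (hsm : ∀ s, IsSmooth F E c v n (f s)) (hflat : ∀ s s' : ℂ, ∀ k ∈ K₀, f s k = f s' k)
  {f' : ℂ → UnitaryGroup.localPi E c (n + n) JD v → ℂ} (hSieg' : ∀ s, IsLocalSiegelSection F E c hcδ hδ hd v n hT₀ hJD χv s (f' s))
  (hflat' : ∀ s s' : ℂ, ∀ k ∈ K₀', f' s k = f' s' k) (hthrough : ∀ x, f' (1 / 2) x = f (1 / 2) x)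
  {Fn : ℂ → UnitaryGroup.localPi E c (n + n) JD v → ℂ} (hFn_reg : ∀ h, IsQRationalRegularAt (residueFieldCard (v.adicCompletion F)) (1 / 2) fun s => Fn s h)
  (hFn : ∀ s : ℂ, 1 < s.re → ∀ h, localIntertwining F E c v n hJD νN (f s) h = aNorm F E c v n χv vol s * Fn s h)
  {Fn' : ℂ → UnitaryGroup.localPi E c (n + n) JD v → ℂ} (hFn'_reg : ∀ h, IsQRationalRegularAt (residueFieldCard (v.adicCompletion F)) (1 / 2) fun s => Fn' s h)
  (hFn' : ∀ s : ℂ, 1 < s.re → ∀ h, localIntertwining F E c v n hJD νN (f' s) h = aNorm F E c v n χv vol' s * Fn' s h)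

omit [Algebra.IsQuadraticExtension F E] in
include hvol in
/-- the volume scaling of the normaliser: `aNorm vol′ s = (vol′∕vol) · aNorm vol s`. [cite: HarrisKudlaSweet1996, §6 (6.14)] -/
theorem aNorm_eq_div_mul_aNorm (s : ℂ) : aNorm F E c v n χv vol' s = ((vol' : ℂ) / (vol : ℂ)) * aNorm F E c v n χv vol s := by
  have hv : (vol : ℂ) ≠ 0 := Complex.ofReal_ne_zero.2 hvol
  rw [aNorm_def, aNorm_def]
  field_simp

include hK₀ hK₀' hIw hIw' hA4R hintA hSieg hsm hflat hSieg' hflat' hthrough hFn_reg hFn hFn'_reg hFn' haN hvol in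
/-- **THE VALUE AT `½` IS INDEPENDENT OF THE IWASAWA COMPACT up to the volume factor.**  `K₀, K₀′ ≤ H_v` compact open with `H_v = P_Δ K₀ = P_Δ K₀′`; `f` the `K₀`-flat
family of smooth Siegel sections through `φ`, `f′` the `K₀′`-flat family of Siegel sections through the same `φ` (`f′(½) = f(½)`), with (A4′-R) values `Fn` (normaliser
volume `vol ≠ 0`) and `Fn′` (volume `vol′`).  Then **`vol′ · Fn′(½) h = vol · Fn(½) h`**. [cite: KudlaSweet1997, §1] [cite: Casselman1980, §3] -/
theorem value_reflatten (h : UnitaryGroup.localPi E c (n + n) JD v) : (vol' : ℂ) * Fn' (1 / 2) h = (vol : ℂ) * Fn (1 / 2) h := by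
  -- Iwasawa choices for both compacts, heights
  choose pI hpI kI hkI hxI using hIw
  choose pI' hpI' kI' hkI' hxI' using hIw'
  have hq0 : (0 : ℝ) < residueFieldCard (v.adicCompletion F) := by exact_mod_cast lt_trans zero_lt_one (one_lt_residueFieldCard (v.adicCompletion F))
  have hq1 : (residueFieldCard (v.adicCompletion F) : ℝ) ≠ 1 := by exact_mod_cast (one_lt_residueFieldCard (v.adicCompletion F)).ne'
  have hqn : residueFieldCard (v.adicCompletion F) ≠ 0 := residueFieldCard_ne_zero _
  have hv : (vol : ℂ) ≠ 0 := Complex.ofReal_ne_zero.2 hvol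
  choose KI hKI using fun x => exists_absDetDelta_eq_zpow F E c hcδ hδ hd v n hT₀ hJD (hpI x)
  choose KI' hKI' using fun x => exists_absDetDelta_eq_zpow F E c hcδ hδ hd v n hT₀ hJD (hpI' x)
  -- both heights: left-multiplicative under `P_Δ`; `ν` right-`K₀`-invariant, `ν′` right-`K₀′`-invariant
  have hν_left : ∀ (p x : UnitaryGroup.localPi E c (n + n) JD v), IsSiegelDelta F E c hcδ hδ hd v n hT₀ hJD p →
      absDetDelta F E c v n (pI (p * x)) = absDetDelta F E c v n p * absDetDelta F E c v n (pI x) := fun p x hp => by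
    rw [← absDetDelta_mul F E c hcδ hδ hd v n hT₀ hJD p (pI x) (hpI x)]
    exact absDetDelta_eq_of_mul_eq_mul F E c hcδ hδ hd v n hT₀ hJD K₀ hK₀.1 (hpI _) (hp.mul (hpI x)) (hkI _) (hkI x)
      (by rw [← hxI (p * x), mul_assoc, ← hxI x])
  have hν'_left : ∀ (p x : UnitaryGroup.localPi E c (n + n) JD v), IsSiegelDelta F E c hcδ hδ hd v n hT₀ hJD p →
      absDetDelta F E c v n (pI' (p * x)) = absDetDelta F E c v n p * absDetDelta F E c v n (pI' x) := fun p x hp => by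
    rw [← absDetDelta_mul F E c hcδ hδ hd v n hT₀ hJD p (pI' x) (hpI' x)]
    exact absDetDelta_eq_of_mul_eq_mul F E c hcδ hδ hd v n hT₀ hJD K₀' hK₀'.1 (hpI' _) (hp.mul (hpI' x)) (hkI' _) (hkI' x)
      (by rw [← hxI' (p * x), mul_assoc, ← hxI' x])
  have hν_right : ∀ (x k : UnitaryGroup.localPi E c (n + n) JD v), k ∈ K₀ →
      absDetDelta F E c v n (pI (x * k)) = absDetDelta F E c v n (pI x) := fun x k hk =>
    absDetDelta_eq_of_mul_eq_mul F E c hcδ hδ hd v n hT₀ hJD K₀ hK₀.1 (hpI _) (hpI x) (hkI _) (K₀.mul_mem (hkI x) hk)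
      (by rw [← hxI (x * k), ← mul_assoc, ← hxI x])
  have hν'_right : ∀ (x k : UnitaryGroup.localPi E c (n + n) JD v), k ∈ K₀' →
      absDetDelta F E c v n (pI' (x * k)) = absDetDelta F E c v n (pI' x) := fun x k hk =>
    absDetDelta_eq_of_mul_eq_mul F E c hcδ hδ hd v n hT₀ hJD K₀' hK₀'.1 (hpI' _) (hpI' x) (hkI' _) (K₀'.mul_mem (hkI' x) hk)
      (by rw [← hxI' (x * k), ← mul_assoc, ← hxI' x])
  -- the ratio exponent `e x := KI′ x − KI x`
  have hratio : ∀ x, (residueFieldCard (v.adicCompletion F) : ℝ) ^ (KI' x - KI x) = absDetDelta F E c v n (pI' x) / absDetDelta F E c v n (pI x) :=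
    fun x => by rw [zpow_sub₀ hq0.ne', hKI', hKI]
  have he_left : ∀ (p x : UnitaryGroup.localPi E c (n + n) JD v), IsSiegelDelta F E c hcδ hδ hd v n hT₀ hJD p → KI' (p * x) - KI (p * x) = KI' x - KI x :=
    fun p x hp => by
    refine zpow_right_injective₀ hq0 hq1 ?_
    simp only [hratio]
    rw [hν_left p x hp, hν'_left p x hp, mul_div_mul_left _ _ (absDetDelta_pos F E c hcδ hδ hd v n hT₀ hJD hp).ne']
  have he_right : ∀ (x u : UnitaryGroup.localPi E c (n + n) JD v), u ∈ K₀ → u ∈ K₀' → KI' (x * u) - KI (x * u) = KI' x - KI x := fun x u hu hu' => by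
    refine zpow_right_injective₀ hq0 hq1 ?_
    simp only [hratio]
    rw [hν_right _ _ hu, hν'_right _ _ hu']
  have he_kI : ∀ x, KI' x - KI x = KI' (kI x) - KI (kI x) := fun x => by
    conv_lhs => rw [hxI x]
    exact he_left (pI x) (kI x) (hpI x)
  -- finitely many values on the compact `K₀`
  haveI : CompactSpace K₀ := isCompact_iff_compactSpace.1 hK₀.1
  have hVopen : IsOpen {u : UnitaryGroup.localPi E c (n + n) JD v | u ∈ K₀ ∧ u ∈ K₀'} := hK₀.2.inter hK₀'.2
  have hlc : IsLocallyConstant fun k : K₀ => KI' (k : UnitaryGroup.localPi E c (n + n) JD v) - KI (k : UnitaryGroup.localPi E c (n + n) JD v) := by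
    refine (IsLocallyConstant.iff_exists_open _).2 fun k => ⟨{k' : K₀ | (k : UnitaryGroup.localPi E c (n + n) JD v)⁻¹ * k' ∈
      {u : UnitaryGroup.localPi E c (n + n) JD v | u ∈ K₀ ∧ u ∈ K₀'}}, hVopen.preimage (continuous_const.mul continuous_subtype_val),
      (show ((k : UnitaryGroup.localPi E c (n + n) JD v)⁻¹ * (k : UnitaryGroup.localPi E c (n + n) JD v) ∈ K₀) ∧
          ((k : UnitaryGroup.localPi E c (n + n) JD v)⁻¹ * (k : UnitaryGroup.localPi E c (n + n) JD v) ∈ K₀') by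
        rw [inv_mul_cancel]; exact ⟨K₀.one_mem, K₀'.one_mem⟩), fun k' hk' => ?_⟩
    have h1 := he_right (k : UnitaryGroup.localPi E c (n + n) JD v) _ hk'.1 hk'.2
    rwa [mul_inv_cancel_left] at h1
  obtain ⟨Mset, hMset⟩ : ∃ Mset : Finset ℤ, ∀ x : UnitaryGroup.localPi E c (n + n) JD v, KI' x - KI x ∈ Mset :=
    ⟨hlc.range_finite.toFinset, fun x => by rw [Set.Finite.mem_toFinset, he_kI x]; exact ⟨⟨kI x, hkI x⟩, rfl⟩⟩
  -- value formulas
  have hfval : ∀ s y, f s y = ((absDetDelta F E c v n (pI y) : ℝ) : ℂ) ^ (s - 1 / 2) * f (1 / 2) y := fun s y => by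
    conv_lhs => rw [hxI y]
    rw [apply_eq_cpow_mul_apply F E c hcδ hδ hd v n hT₀ hJD χv hSieg hflat (hpI y) (hkI y) s (1 / 2), ← hxI y]
  have hf'val : ∀ s y, f' s y = ((absDetDelta F E c v n (pI' y) : ℝ) : ℂ) ^ (s - 1 / 2) * f (1 / 2) y := fun s y => by
    conv_lhs => rw [hxI' y]
    rw [apply_eq_cpow_mul_apply F E c hcδ hδ hd v n hT₀ hJD χv hSieg' hflat' (hpI' y) (hkI' y) s (1 / 2), ← hxI' y, hthrough]
  -- the pieces `𝟙[e = m] · f` are `K₀`-flat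
  obtain ⟨piece, hpiece⟩ : ∃ piece : ℤ → ℂ → UnitaryGroup.localPi E c (n + n) JD v → ℂ, piece = fun m s x => if KI' x - KI x = m then f s x else 0 := ⟨_, rfl⟩
  have hpS : ∀ m s, IsLocalSiegelSection F E c hcδ hδ hd v n hT₀ hJD χv s (piece m s) := fun m s p hp x => by
    simp only [hpiece, he_left p x hp, hSieg s p hp x]
    split_ifs <;> simp
  have hpsm : ∀ m s, IsSmooth F E c v n (piece m s) := fun m s => by
    obtain ⟨U, hU⟩ := hsm s
    refine ⟨(⟨K₀, hK₀.2⟩ ⊓ ⟨K₀', hK₀'.2⟩) ⊓ U, fun x u hu => ?_⟩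
    have hu' : (u ∈ K₀ ∧ u ∈ K₀') ∧ u ∈ (U : Subgroup _) := by simpa [OpenSubgroup.coe_inf] using hu
    simp only [hpiece, he_right x u hu'.1.1 hu'.1.2, hU x u hu'.2]
  have hpfl : ∀ m (s s' : ℂ), ∀ k ∈ K₀, piece m s k = piece m s' k := fun m s s' k hk => by simp only [hpiece, hflat s s' k hk]
  choose Fnp hFnp_reg hFnp using fun m => hA4R (piece m) (hpS m) (hpsm m) (hpfl m)
  have hpint := fun m => hintA (piece m) (hpS m) (hpsm m) (hpfl m)
  -- the two sum identities
  have hsum_f : ∀ s x, f s x = ∑ m ∈ Mset, (fun (_ : ℤ) (_ : ℂ) => (1 : ℂ)) m s * piece m s x := fun s x => by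
    simp only [hpiece, one_mul, Finset.sum_ite_eq, if_pos (hMset x)]
  have hsum_f' : ∀ s : ℂ, 1 < s.re → ∀ x, f' s x =
      ∑ m ∈ Mset, (fun (m : ℤ) (s : ℂ) => (((residueFieldCard (v.adicCompletion F) : ℝ) ^ m : ℝ) : ℂ) ^ (s - 1 / 2)) m s * piece m s x := fun s _ x => by
    simp only [hpiece, mul_ite, mul_zero, Finset.sum_ite_eq, if_pos (hMset x)]
    rw [hf'val s x, hfval s x, ← mul_assoc, ← Complex.mul_cpow_ofReal_nonneg (zpow_nonneg hq0.le _) (absDetDelta_nonneg F E c v n _), ← Complex.ofReal_mul,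
      hratio, div_mul_cancel₀ _ (absDetDelta_pos F E c hcδ hδ hd v n hT₀ hJD (hpI x)).ne']
  -- ★ V1 `value_eq_sum` twice (the second time with the normaliser rescaled to `vol`)
  have hG : Fn (1 / 2) h = ∑ m ∈ Mset, (fun (_ : ℤ) (_ : ℂ) => (1 : ℂ)) m (1 / 2) * Fnp m (1 / 2) h :=
    value_eq_sum F E c v n hJD νN χv vol haN Mset _ (fun _ _ => isQRationalRegularAt_const _ _ _) piece Fnp h (fun m _ => hFnp_reg m h)
      (fun m _ s hs => hFnp m s hs h) (fun m _ s hs => hpint m s hs h) f (fun s _ x => hsum_f s x) (fun s => Fn s h) (hFn_reg h) (fun s hs => hFn s hs h)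
  have hG' : ((vol' : ℂ) / (vol : ℂ)) * Fn' (1 / 2) h = ∑ m ∈ Mset,
      (fun (m : ℤ) (s : ℂ) => (((residueFieldCard (v.adicCompletion F) : ℝ) ^ m : ℝ) : ℂ) ^ (s - 1 / 2)) m (1 / 2) * Fnp m (1 / 2) h := by
    refine value_eq_sum F E c v n hJD νN χv vol haN Mset _ (fun m _ => ?_) piece Fnp h (fun m _ => hFnp_reg m h)
      (fun m _ s hs => hFnp m s hs h) (fun m _ s hs => hpint m s hs h) f' hsum_f' (fun s => ((vol' : ℂ) / (vol : ℂ)) * Fn' s h)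
      ((hFn'_reg h).const_mul _) (fun s hs => ?_)
    · exact (isQRationalRegularAt_zpow_cpow_add hqn m (-(1 / 2)) (1 / 2)).congr fun s => by rw [sub_eq_add_neg]
    · rw [hFn' s hs h, aNorm_eq_div_mul_aNorm F E c v n χv vol vol' hvol s]; ring
  have hsum : ((vol' : ℂ) / (vol : ℂ)) * Fn' (1 / 2) h = Fn (1 / 2) h := by
    rw [hG, hG']
    refine Finset.sum_congr rfl fun m _ => ?_
    simp only [sub_self, Complex.cpow_zero]
  rw [← hsum]
  field_simp

end Summit.HodgeConjecture.HodgeConjecture.Cruxes.HLiu418.K2LiuA7ValueReflatten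

end
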